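import Mathlib
import Summits.Ventures.PercRepro2.CoinChainXAMGateFacts

/-!
# Weighted Ahlswede–Daykin facts between the cells of the chain — the generic lemma
(blind cell PercRepro2, night-2 g31; proofs/NIGHT2-DARC.md §73.6)

`cell_fact`: for four laws on the regions `PA, PB` (meets in `PM`, joins in `PJ`) satisfying the pointwise law
inequality `L₁ s · L₂ t ≤ L₃ (s ∩ t) · L₄ (s ∪ t)`, and four nonnegative weights with `w₁ s · w₂ t ≤ w₃ (s ∩ t) · w₄ (s ∪ t)`,
the set-level inequality `(Σ_{PA} ν L₁ w₁)(Σ_{PB} ν L₂ w₂) ≤ (Σ_{PM} ν L₃ w₃)(Σ_{PJ} ν L₄ w₄)` — `ad_sets_dec` with the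
three factors combined.  The weight inequalities for the CELL weights of two point markers (`(1 − x)(1 − y)`,
`x(1 − y)`, `(1 − x)y`, `xy` and the up-sets) are the lemmas `cw_*`, each a 0/1 case split; the law inequalities are
the standing hypotheses (`hcd`, `hdd`, `closed_gate_pw`, `cg_piece_pw`).  The eleven cell facts of the (M⁻)
programme (`K₁·b ≤ (a + K₀)·b₁`, …) are instances.
-/

namespace Summit.Ventures.PercRepro2.Coin

open Classical

section CellFactGeneric

variable {V : Type*} [DecidableEq V] {R : Type*} [Field R] [LinearOrder R] [IsStrictOrderedRing R]

/-- **The generic weighted cell fact.** -/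
theorem cell_fact (U : Finset V) (ν L₁ L₂ L₃ L₄ w₁ w₂ w₃ w₄ : Finset V → R)
    (PA PB PM PJ : Finset V → Prop) [DecidablePred PA] [DecidablePred PB] [DecidablePred PM] [DecidablePred PJ]
    (hν0 : ∀ W, 0 ≤ ν W) (hν : ∀ s ⊆ U, ∀ t ⊆ U, ν s * ν t ≤ ν (s ∩ t) * ν (s ∪ t))
    (h1 : ∀ W, 0 ≤ L₁ W) (h2 : ∀ W, 0 ≤ L₂ W) (h3 : ∀ W, 0 ≤ L₃ W) (h4 : ∀ W, 0 ≤ L₄ W)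
    (hw1 : ∀ W, 0 ≤ w₁ W) (hw2 : ∀ W, 0 ≤ w₂ W) (hw3 : ∀ W, 0 ≤ w₃ W) (hw4 : ∀ W, 0 ≤ w₄ W)
    (hreg : ∀ s t, PA s → PB t → PM (s ∩ t) ∧ PJ (s ∪ t))
    (hlaw : ∀ s t, PA s → PB t → L₁ s * L₂ t ≤ L₃ (s ∩ t) * L₄ (s ∪ t))
    (hw : ∀ s t, w₁ s * w₂ t ≤ w₃ (s ∩ t) * w₄ (s ∪ t)) :
    (∑ W ∈ U.powerset.filter PA, ν W * L₁ W * w₁ W) * (∑ W ∈ U.powerset.filter PB, ν W * L₂ W * w₂ W) ≤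
      (∑ W ∈ U.powerset.filter PM, ν W * L₃ W * w₃ W) * (∑ W ∈ U.powerset.filter PJ, ν W * L₄ W * w₄ W) := by
  refine ad_sets_dec U (fun W => ν W * L₁ W * w₁ W) (fun W => ν W * L₂ W * w₂ W)
    (fun W => ν W * L₃ W * w₃ W) (fun W => ν W * L₄ W * w₄ W)
    (fun W => mul_nonneg (mul_nonneg (hν0 W) (h1 W)) (hw1 W)) (fun W => mul_nonneg (mul_nonneg (hν0 W) (h2 W)) (hw2 W))
    (fun W => mul_nonneg (mul_nonneg (hν0 W) (h3 W)) (hw3 W)) (fun W => mul_nonneg (mul_nonneg (hν0 W) (h4 W)) (hw4 W))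
    PA PB PM PJ ?_
  intro s hs t ht hA hB
  refine ⟨(hreg s t hA hB).1, (hreg s t hA hB).2, ?_⟩
  calc ν s * L₁ s * w₁ s * (ν t * L₂ t * w₂ t) = (ν s * ν t) * (L₁ s * L₂ t) * (w₁ s * w₂ t) := by ring
    _ ≤ (ν (s ∩ t) * ν (s ∪ t)) * (L₃ (s ∩ t) * L₄ (s ∪ t)) * (w₃ (s ∩ t) * w₄ (s ∪ t)) :=
        mul_le_mul (mul_le_mul (hν s hs t ht) (hlaw s t hA hB) (mul_nonneg (h1 s) (h2 t)) (mul_nonneg (hν0 _) (hν0 _)))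
          (hw s t) (mul_nonneg (hw1 s) (hw2 t))
          (mul_nonneg (mul_nonneg (hν0 _) (hν0 _)) (mul_nonneg (h3 _) (h4 _)))
    _ = ν (s ∩ t) * L₃ (s ∩ t) * w₃ (s ∩ t) * (ν (s ∪ t) * L₄ (s ∪ t) * w₄ (s ∪ t)) := by ring

end CellFactGeneric

section CellWeights

variable {V : Type*} [DecidableEq V] {R : Type*} [Field R] [LinearOrder R] [IsStrictOrderedRing R]
variable (j j' : V) (x y : Finset V → R) (hx : ∀ W, x W = if j ∈ W then 1 else 0) (hy : ∀ W, y W = if j' ∈ W then 1 else 0)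

include hx hy in
/-- `x(1−y)` on `s`, `(1−x)(1−y)` on `t` → `(1−x)(1−y)` on the meet, `x(1−y)` on the join. -/
theorem cw_x0_00 (s t : Finset V) :
    (x s * (1 - y s)) * ((1 - x t) * (1 - y t)) ≤ ((1 - x (s ∩ t)) * (1 - y (s ∩ t))) * (x (s ∪ t) * (1 - y (s ∪ t))) := by
  rw [mg_x_inter j x hx, mg_x_inter j' y hy, mg_x_union j x hx, mg_x_union j' y hy]
  rcases mg_marker_cases j x hx s with hxs | hxs <;> rcases mg_marker_cases j x hx t with hxt | hxt <;>
    rcases mg_marker_cases j' y hy s with hys | hys <;> rcases mg_marker_cases j' y hy t with hyt | hyt <;>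
    simp only [hxs, hxt, hys, hyt] <;> norm_num

include hx hy in
/-- `x(1−y)` on `s`, `(1−x)y` on `t` → `(1−x)(1−y)` on the meet, `xy` on the join. -/
theorem cw_x0_0y (s t : Finset V) :
    (x s * (1 - y s)) * ((1 - x t) * y t) ≤ ((1 - x (s ∩ t)) * (1 - y (s ∩ t))) * (x (s ∪ t) * y (s ∪ t)) := by
  rw [mg_x_inter j x hx, mg_x_inter j' y hy, mg_x_union j x hx, mg_x_union j' y hy]
  rcases mg_marker_cases j x hx s with hxs | hxs <;> rcases mg_marker_cases j x hx t with hxt | hxt <;>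
    rcases mg_marker_cases j' y hy s with hys | hys <;> rcases mg_marker_cases j' y hy t with hyt | hyt <;>
    simp only [hxs, hxt, hys, hyt] <;> norm_num

include hx hy in
/-- `xy` on `s`, `(1−x)(1−y)` on `t` → `(1−x)(1−y)` on the meet, `xy` on the join. -/
theorem cw_xy_00 (s t : Finset V) :
    (x s * y s) * ((1 - x t) * (1 - y t)) ≤ ((1 - x (s ∩ t)) * (1 - y (s ∩ t))) * (x (s ∪ t) * y (s ∪ t)) := by
  rw [mg_x_inter j x hx, mg_x_inter j' y hy, mg_x_union j x hx, mg_x_union j' y hy]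
  rcases mg_marker_cases j x hx s with hxs | hxs <;> rcases mg_marker_cases j x hx t with hxt | hxt <;>
    rcases mg_marker_cases j' y hy s with hys | hys <;> rcases mg_marker_cases j' y hy t with hyt | hyt <;>
    simp only [hxs, hxt, hys, hyt] <;> norm_num

include hx hy in
/-- `(1−x)(1−y)` on both → `(1−x)(1−y)` on both (the unmarked cell is a sublattice). -/
theorem cw_00_00 (s t : Finset V) :
    ((1 - x s) * (1 - y s)) * ((1 - x t) * (1 - y t)) ≤ ((1 - x (s ∩ t)) * (1 - y (s ∩ t))) * ((1 - x (s ∪ t)) * (1 - y (s ∪ t))) := by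
  rw [mg_x_inter j x hx, mg_x_inter j' y hy, mg_x_union j x hx, mg_x_union j' y hy]
  rcases mg_marker_cases j x hx s with hxs | hxs <;> rcases mg_marker_cases j x hx t with hxt | hxt <;>
    rcases mg_marker_cases j' y hy s with hys | hys <;> rcases mg_marker_cases j' y hy t with hyt | hyt <;>
    simp only [hxs, hxt, hys, hyt] <;> norm_num

include hx hy in
/-- `x(1−y)` on `s`, `x(1−y)` on `t` → `(1−y)` (any `x`) on the meet … stated with `(1−x)(1−y) + x(1−y) = 1 − y`:
`x(1−y)·x(1−y) ≤ (1−y)(meet)·x(1−y)(join)`. -/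
theorem cw_x0_x0 (s t : Finset V) :
    (x s * (1 - y s)) * (x t * (1 - y t)) ≤ (1 - y (s ∩ t)) * (x (s ∪ t) * (1 - y (s ∪ t))) := by
  rw [mg_x_inter j' y hy, mg_x_union j x hx, mg_x_union j' y hy]
  rcases mg_marker_cases j x hx s with hxs | hxs <;> rcases mg_marker_cases j x hx t with hxt | hxt <;>
    rcases mg_marker_cases j' y hy s with hys | hys <;> rcases mg_marker_cases j' y hy t with hyt | hyt <;>
    simp only [hxs, hxt, hys, hyt] <;> norm_num

end CellWeights

end Summit.Ventures.PercRepro2.Coin
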